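import Summits.MatrixMultiplication.MatrixMultiplication.Theses.LinearSolveSplit
import Summits.MatrixMultiplication.MatrixMultiplication.Theorems.LinearSolveSplitSlsExponentFloorGeneric


/-!
# `SlsExponentFloor` — the exponent of one generic linear solve is at least two (proof)

Item `stmt-MatrixMultiplication-28411` (`Theses.LinearSolveSplit.SlsExponentFloor`, aside / support item of
`route-MatrixMultiplication-LinearSolveSplit`, decomp-mm lens 3; the critic's ask w2
«two_le_of_slsAdmissibleAt»): in the tree's `Derivable` model (straight-line programs with
division over `ℂ(X, b)`, constants free, BCS 1997 Def. (4.4)/(4.7)), if for all large `n` the `n`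
solution coordinates `X⁻¹ b` of the GENERIC `n × n` system `[X | b]` are derivable from the entries
of `[X | b]` in `≤ C·n^τ` steps, then `τ ≥ 2`. So the cheap cost model of the route's crux
`SlsQuadratic` («every τ > 2 is admissible») is not junk: the crux sits exactly at the floor.

Proof (input-reading bound, BCS 1997 Rem. (4.10)/(16.2)): a computation sequence of length `s` reads
at most `2s` available elements (each step has two operands), `finset_restrict`; a ring endomorphism
of the ambient field fixing the constants and every element read fixes every element computed,
`fixed_of_divSeq`. If `2s < n²`, some variable `x_v` of the `n(n+1)` entries of `[X | b]` is
neither read nor itself one of the `n` outputs, so the shift `x_v ↦ x_v + 1` (an injective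
`ℂ`-algebra endomorphism of `ℂ[X, b]`, lifted to `ℂ(X, b)` by `IsFractionRing.liftAlgHom`) fixes
the solution `u = X⁻¹ b` while moving the system: applying it to `X u = b` gives `1 = 0` if `x_v`
is an entry of `b`, and `u_q = 0` if `x_v = x_{pq}`, contradicting Cramer's rule
(`det X · u_q = det X[b → col q] ≠ 0`, a generic determinant). Hence `n² ≤ 2s`
(`sq_le_two_mul_of_derivable`), and `n² ≤ 2C·n^τ` for all large `n` forces `τ ≥ 2`.

Main theorem: `slsExponentFloor_holds : Theses.LinearSolveSplit.SlsExponentFloor` (0 sorry).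

Landing note: the lens-3 kernel `SlsExponentFloor.lean` (decomp-mm gen 5; sha256 96f85062…9cab, 421 lines, rc 0 ·
0 sorry · audit ok:true, critic-endorsed 2026-08-30T05:29:09Z) is landed as two files for the gate rule «Theorems files
with proofs ≤ 400 lines» — `LinearSolveSplitSlsExponentFloorGeneric` (§1 two structural facts about computation
sequences, §2 the generic system `[X | b]`, generic determinants, the shift endomorphisms `x_v ↦ x_v + c`; imports no
route file) and `LinearSolveSplitSlsExponentFloor` (§3 the floor `n² ≤ 2s`, §4 the closer `slsExponentFloor_holds`);
statements and proofs unchanged (18 helper docstrings added), one namespace throughout.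
-/

set_option linter.dupNamespace false -- `MatrixMultiplication.MatrixMultiplication` (summit = problem, D-0017)

noncomputable section

open scoped BigOperators Matrix
open Literature.Computability.AlgebraicComplexity (Derivable DivStep DivSeq)

namespace Summit.MatrixMultiplication.MatrixMultiplication.Theorems.LinearSolveSplitSlsExponentFloor

/-! ## 3. The floor: `n² ≤ 2s` -/

/-- **Input-reading bound.** If the `n` solution coordinates of the generic `n × n` system are
derivable from the entries of `[X | b]` in `s` steps, then `n² ≤ 2s`. -/
theorem sq_le_two_mul_of_derivable {n s : ℕ}
    (h : Derivable ℂ s (Set.range (gE n)) (Set.range (sysSolution n))) : n ^ 2 ≤ 2 * s := by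
  classical
  by_contra hlt
  push Not at hlt
  obtain ⟨l, hl, hlen, hout⟩ := h
  obtain ⟨R, hRA, hRcard, hR⟩ := finset_restrict hl
  -- the indices of the variables that are read, resp. that are outputs
  set B₁ : Finset (Idx n) := Finset.univ.filter (fun w => gE n w ∈ R) with hB₁
  set B₂ : Finset (Idx n) :=
    Finset.univ.filter (fun w => gE n w ∈ Finset.univ.image (sysSolution n)) with hB₂
  have h₁ : B₁.card ≤ R.card :=
    Finset.card_le_card_of_injOn (gE n) (fun w hw => (Finset.mem_filter.mp hw).2)
      (gE_injective n).injOn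
  have h₂ : B₂.card ≤ n :=
    (Finset.card_le_card_of_injOn (gE n) (fun w hw => (Finset.mem_filter.mp hw).2)
      (gE_injective n).injOn).trans (Finset.card_image_le.trans (by simp))
  have hcard : (B₁ ∪ B₂).card < (Finset.univ : Finset (Idx n)).card := by
    calc (B₁ ∪ B₂).card ≤ B₁.card + B₂.card := Finset.card_union_le _ _
      _ ≤ 2 * s + n := by omega
      _ < n ^ 2 + n := by omega
      _ = (Finset.univ : Finset (Idx n)).card := by
          rw [Finset.card_univ, Fintype.card_prod, Fintype.card_fin, Fintype.card_fin]; ring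
  obtain ⟨v, -, hv⟩ := Finset.exists_mem_notMem_of_card_lt_card hcard
  have hvR : gE n v ∉ R := fun hm =>
    hv (Finset.mem_union_left _ (Finset.mem_filter.mpr ⟨Finset.mem_univ _, hm⟩))
  have hvu : ∀ i, sysSolution n i ≠ gE n v := fun i hi =>
    hv (Finset.mem_union_right _ (Finset.mem_filter.mpr
      ⟨Finset.mem_univ _, Finset.mem_image.mpr ⟨i, Finset.mem_univ _, hi⟩⟩))
  -- the shift `x_v ↦ x_v + 1` fixes everything read, hence everything computed, hence `u`
  have hσR : ∀ a ∈ (↑R : Set (GF n)), shift n v a = a := by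
    intro a ha
    obtain ⟨w, rfl⟩ := hRA ha
    have hw : w ≠ v := fun hwv => hvR (by rw [← hwv]; exact Finset.mem_coe.mp ha)
    exact shift_gE_of_ne hw
  have hσl : ∀ w ∈ l, shift n v w = w :=
    fixed_of_divSeq (shift n v) (fun c => AlgHom.commutes (shift n v) c) hσR hR
  have hσu : ∀ i, shift n v (sysSolution n i) = sysSolution n i := by
    intro i
    rcases hout ⟨i, rfl⟩ with (⟨w, hw⟩ | ⟨c, hc⟩) | hl'
    · have hne : w ≠ v := fun hwv => hvu i (by rw [← hw, hwv])
      rw [← hw]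
      exact shift_gE_of_ne hne
    · rw [← hc]
      exact AlgHom.commutes _ _
    · exact hσl _ hl'
  -- apply the shift to `X u = b`
  have hmap : ∀ i, shift n v (sysRhs n i) = ((sysMatrix n).map (shift n v) *ᵥ sysSolution n) i := by
    intro i
    have h := RingHom.map_mulVec (shift n v : GF n →+* GF n) (sysMatrix n) (sysSolution n) i
    rw [sysMatrix_mulVec_sysSolution] at h
    have hcomp : ((shift n v : GF n →+* GF n) ∘ sysSolution n) = sysSolution n :=
      funext fun j => hσu j
    rw [hcomp] at h
    simpa only [RingHom.coe_coe] using h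
  obtain ⟨p, c⟩ := v
  rcases Fin.eq_castSucc_or_eq_last c with ⟨q, rfl⟩ | rfl
  · -- `x_v = x_{pq}` is an entry of `X`: row `p` of the shifted system reads `b_p = b_p + u_q`
    have hb : shift n (p, Fin.castSucc q) (sysRhs n p) = sysRhs n p :=
      shift_gE_of_ne fun h => (Fin.castSucc_lt_last q).ne' (congrArg Prod.snd h)
    have hentry : ∀ j, shift n (p, Fin.castSucc q) (sysMatrix n p j) =
        sysMatrix n p j + if j = q then 1 else 0 := by
      intro j
      rw [sysMatrix_apply]
      by_cases hj : j = q
      · subst hj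
        rw [if_pos rfl, shift_gE_self]
      · rw [if_neg hj, add_zero]
        exact shift_gE_of_ne fun h => hj (Fin.castSucc_injective _ (congrArg Prod.snd h))
    have hrow : ((sysMatrix n).map (shift n (p, Fin.castSucc q)) *ᵥ sysSolution n) p =
        sysRhs n p + sysSolution n q := by
      have hXu := congrFun (sysMatrix_mulVec_sysSolution n) p
      simp only [Matrix.mulVec, dotProduct, Matrix.map_apply] at hXu ⊢
      simp_rw [hentry, add_mul, Finset.sum_add_distrib, hXu, ite_mul, one_mul, zero_mul,
        Finset.sum_ite_eq', Finset.mem_univ, if_true]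
    have huq : sysSolution n q = 0 := by
      have := hmap p
      rw [hb, hrow] at this
      exact left_eq_add.mp this
    have hdet := det_mul_sysSolution (n := n) q
    rw [huq, mul_zero, updateCol_eq_colSel] at hdet
    exact det_colSel_ne_zero (update_castSucc_injective q) hdet.symm
  · -- `x_v = b_p`: row `p` of the shifted system reads `b_p + 1 = b_p`
    have hM : (sysMatrix n).map (shift n (p, Fin.last n)) = sysMatrix n := by
      ext i j
      rw [Matrix.map_apply, sysMatrix_apply]
      exact shift_gE_of_ne fun h => (Fin.castSucc_lt_last j).ne (congrArg Prod.snd h)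
    have := hmap p
    rw [hM, sysMatrix_mulVec_sysSolution, sysRhs_apply, shift_gE_self] at this
    exact one_ne_zero (add_eq_left.mp this)

/-! ## 4. The exponent floor -/

/-- **`ω(SLS) ≥ 2` in the tree's model** (the statement of item stmt-MatrixMultiplication-28411, verbatim):
an admissible exponent `τ` for one generic linear solve satisfies `2 ≤ τ`. -/
theorem two_le_of_slsAdmissible :
    ∀ τ : ℝ, (∃ C : ℝ, ∃ n₀ : ℕ, ∀ n ≥ n₀, ∃ s : ℕ, (s : ℝ) ≤ C * (n : ℝ) ^ τ ∧ Literature.Computability.AlgebraicComplexity.Derivable ℂ s (Set.range fun p : Fin n × Fin (n + 1) => algebraMap (MvPolynomial (Fin n × Fin (n + 1)) ℂ) (FractionRing (MvPolynomial (Fin n × Fin (n + 1)) ℂ)) (MvPolynomial.X p)) (Set.range (Matrix.mulVec (Matrix.of fun i j : Fin n => algebraMap (MvPolynomial (Fin n × Fin (n + 1)) ℂ) (FractionRing (MvPolynomial (Fin n × Fin (n + 1)) ℂ)) (MvPolynomial.X (i, Fin.castSucc j)))⁻¹ fun i : Fin n => algebraMap (MvPolynomial (Fin n × Fin (n + 1))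 ℂ) (FractionRing (MvPolynomial (Fin n × Fin (n + 1)) ℂ)) (MvPolynomial.X (i, Fin.last n))))) → 2 ≤ τ := by
  rintro τ ⟨C, n₀, hC⟩
  by_contra hτ
  push Not at hτ
  have key : ∀ n : ℕ, max n₀ 1 ≤ n → (n : ℝ) ^ ((2 : ℝ) - τ) ≤ 2 * C := by
    intro n hn
    have hn₀ : n₀ ≤ n := le_of_max_le_left hn
    have hn1 : 1 ≤ n := le_of_max_le_right hn
    obtain ⟨s, hs, hD⟩ := hC n hn₀
    have hfloor : n ^ 2 ≤ 2 * s := sq_le_two_mul_of_derivable hD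
    have hpos : (0 : ℝ) < n := by exact_mod_cast hn1
    have h1 : (n : ℝ) ^ (2 : ℝ) ≤ 2 * C * (n : ℝ) ^ τ := by
      rw [Real.rpow_two]
      calc (n : ℝ) ^ 2 = ((n ^ 2 : ℕ) : ℝ) := by push_cast; ring
        _ ≤ ((2 * s : ℕ) : ℝ) := by exact_mod_cast hfloor
        _ = 2 * (s : ℝ) := by push_cast; ring
        _ ≤ 2 * (C * (n : ℝ) ^ τ) := by linarith
        _ = 2 * C * (n : ℝ) ^ τ := by ring
    rw [Real.rpow_sub hpos, div_le_iff₀ (Real.rpow_pos_of_pos hpos τ)]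
    exact h1
  have htend : Filter.Tendsto (fun n : ℕ => (n : ℝ) ^ ((2 : ℝ) - τ)) Filter.atTop Filter.atTop :=
    (tendsto_rpow_atTop (by linarith)).comp tendsto_natCast_atTop_atTop
  obtain ⟨n, hn1, hn2⟩ :=
    ((htend.eventually_gt_atTop (2 * C)).and (Filter.eventually_ge_atTop (max n₀ 1))).exists
  exact absurd (key n hn2) (not_le.mpr hn1)

/-- **`SlsExponentFloor` holds** (item stmt-MatrixMultiplication-28411 of route LinearSolveSplit, by name). -/
theorem slsExponentFloor_holds :
    Summit.MatrixMultiplication.MatrixMultiplication.Theses.LinearSolveSplit.SlsExponentFloor :=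
  two_le_of_slsAdmissible

end Summit.MatrixMultiplication.MatrixMultiplication.Theorems.LinearSolveSplitSlsExponentFloor

end
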